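import Summits.BirchSwinnertonDyer.BirchSwinnertonDyer.Theorems.SylvesterTwoHeegnerIndexTwoPrimitiveDescent
import Summits.BirchSwinnertonDyer.BirchSwinnertonDyer.Theorems.SylvesterTwoHeegnerIndexFrameConstants
import Literature.NumberTheory.QuadraticFields.SquareRootGenerator
import HarnessLib

/-!
# Route `SylvesterTwoHeegnerIndex` (rung K7t), item 19580 `TwoAdicPairHSY`: Hu–Shu–Yin's generator
# is NOT HALVABLE in `E_p(K)`, `E_p(K)[2] = 0`, and the two residue-class layers of the
# non-negativity (part 2)

Cell `bsd-cm`, seat `bsd-cm-two` (prover-bsd-cm-two-g5-0; planner D104 (ii)). PARTITION (D55):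
CornerF at `p = 2` (B14/O12) × 𝒞_HSY × `p = 2` — types-the-object-of (kernel helper `--supports
stmt-BirchSwinnertonDyer-19580`); closes no cell and no item; BSD is not claimed. Everything is
PROVED (no named fact, no definition); sequel of `…TwoPrimitiveDescent.lean`.

* §4 **Non-halvability of a rational generator**: for `W = W₀ ⊗ K` with `W₀/ℚ`, `K/ℚ` quadratic and
  `W(K)[2] = 0`, a point `P` with rational coordinates, of infinite order, through which every
  rational-coordinate point is an integer multiple modulo torsion, satisfies `P ∉ 2·W(K) + tors`
  (torsion is odd, so `P = 2Q`; `σQ − Q ∈ W(K)[2] = 0` for the non-trivial automorphism `σ` of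
  `K/ℚ`; `Q` has rational coordinates; `(1 − 2m)·P` would be torsion) — Silverman *AEC* X.1, the
  first step of a `2`-descent over `K`.
* §5 `E_p(K)[2] = 0` for `E_p : y² = x³ − 432p²` (`p` odd prime) over a quadratic field — BY NAME
  from x1b GEN 47's `SylvesterTwoFrame.two_torsion_eq_zero_cubeSumCurve_of_finrank_eq_two`
  (`…FrameConstants.lean`), re-keyed to `ℤ`-scalars.
* §6 the two layers of 19580's non-negativity in x1b's `θ`-currency on `E_p ⊗ K`: with
  `n·Y = a·P + b·θP + T` along Hu–Shu–Yin's generator `P`,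
  `padicValRat_two_coordinate_nonneg` (`0 ≤ ord₂((a² − ab + b²)/n²)`: the `p ≡ 4 (9)` layer,
  class-wide, UNCONDITIONAL) and `two_le_padicValRat_two_coordinate_of_twoDivisible` (`≥ 2` when
  `Y ∈ 2·E_p(K) + tors` — the `p ≡ 7 (9)` layer, whose hypothesis is MEMO bsd-cm-two THEOREM C:
  refereed, NOT in print, displayed, never a Literature fact).

What remains for 19580 after x1b's parity files + these two: the ASSEMBLY with x1b's Hu–Shu–Yin
(bsd)-display fact (F3), once it lands: `ord₂(#Ш_an(E_p)·#Ш_an(E_{3p²})) = i + ord₂((a² − ab + b²)/n²)`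
with `i = 0 | −2`, hence `= 2m`, `m ∈ ℕ`, for `p ≡ 4 (9)` unconditionally and for `p ≡ 7 (9)` modulo
Theorem C.

## References
* Y. Hu, J. Shu, H. Yin, Trans. AMS 372 (2019) = arXiv:1708.05266, pp. 4, 8, 12.
* J. H. Silverman, *The Arithmetic of Elliptic Curves*, GTM 106, VIII.9.3, X.1.
* MEMO bsd-cm-two v2.6 §15.1 (odd-index lemma), §15.5 (Theorem C).
-/

set_option autoImplicit false
-- the Summit-side namespace `Summit.BirchSwinnertonDyer.BirchSwinnertonDyer.…` (summit = problem) is mandated by D-0017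
set_option linter.dupNamespace false

noncomputable section

open scoped Classical

open WeierstrassCurve WeierstrassCurve.Affine WeierstrassCurve.Affine.Point
  Summit.BirchSwinnertonDyer.BirchSwinnertonDyer.Theorems.SylvesterTwoCMNormForm
  Literature.NumberTheory.EllipticCurves.HuShuYin2019

namespace Summit.BirchSwinnertonDyer.BirchSwinnertonDyer.Theorems.SylvesterTwoNonneg

/-! ## §4 A rational generator is not halvable in `W(K)` when `W(K)[2] = 0` (`K/ℚ` quadratic) -/

section Generator

variable {W₀ : WeierstrassCurve ℚ} {K : Type} [Field K] [NumberField K]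

/-- In an abelian group without elements of order `2`, every torsion element is twice a torsion
element (its order `m` is odd and `T = 2·((m+1)/2)·T`). [folklore] -/
theorem exists_torsion_eq_two_smul {M : Type*} [AddCommGroup M]
    (h2 : ∀ Q : M, (2 : ℤ) • Q = 0 → Q = 0) {T : M} (hT : IsOfFinAddOrder T) :
    ∃ T₁ : M, IsOfFinAddOrder T₁ ∧ T = (2 : ℤ) • T₁ := by
  have hm0 : 0 < addOrderOf T := hT.addOrderOf_pos
  have hmT : addOrderOf T • T = 0 := addOrderOf_nsmul_eq_zero T
  rcases Nat.even_or_odd (addOrderOf T) with ⟨m', hm'⟩ | ⟨j, hj⟩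
  · exfalso
    have h0 : (2 : ℤ) • (m' • T) = 0 := by
      rw [two_zsmul, ← add_nsmul, ← hm', hmT]
    have hm'T : m' • T = 0 := h2 _ h0
    have hdvd : addOrderOf T ∣ m' := addOrderOf_dvd_of_nsmul_eq_zero hm'T
    have hm'0 : 0 < m' := by omega
    have := Nat.le_of_dvd hm'0 hdvd
    omega
  · refine ⟨(j + 1) • T, hT.nsmul, ?_⟩
    rw [two_zsmul, ← add_nsmul, show j + 1 + (j + 1) = addOrderOf T + 1 by omega, add_nsmul,
      hmT, one_nsmul, zero_add]

/-- **A rational generator is not halvable over a quadratic field without `2`-torsion.** Let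
`W = W₀ ⊗ K` (`W₀/ℚ`, `K/ℚ` quadratic) with `W(K)[2] = 0`, and let `P ∈ W(K)` be a point WITH
RATIONAL COORDINATES, of infinite order, such that every point with rational coordinates is an
integer multiple of `P` modulo torsion. Then `P ≠ 2·Z + T` for all `Z ∈ W(K)`, `T` torsion: torsion
is odd (`exists_torsion_eq_two_smul`), so `P = 2Q`; the non-trivial automorphism `σ` of `K/ℚ` fixes
`P`, so `2(σQ − Q) = 0`, `σQ = Q`, `Q` has rational coordinates (tree
`Quadratic.exists_eq_algebraMap_of_apply_eq`), `Q ≡ mP`, and `(1 − 2m)·P` would be torsion.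
(Silverman, *AEC* X.1: the first step of a `2`-descent over `K`.) [cite: SilvermanAEC2009, X.1] -/
theorem ne_two_smul_add_torsion_of_generator (h2K : Module.finrank ℚ K = 2)
    (hE2 : ∀ Q : (W₀.baseChange K).toAffine.Point, (2 : ℤ) • Q = 0 → Q = 0) {xP yP : ℚ}
    (hP : (W₀.baseChange K).toAffine.Nonsingular (algebraMap ℚ K xP) (algebraMap ℚ K yP))
    (hPinf : ¬ IsOfFinAddOrder (Affine.Point.some _ _ hP : (W₀.baseChange K).toAffine.Point))
    (hgen : ∀ (x y : ℚ)
      (hQ : (W₀.baseChange K).toAffine.Nonsingular (algebraMap ℚ K x) (algebraMap ℚ K y)),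
      ∃ m : ℤ, (Affine.Point.some _ _ hQ : (W₀.baseChange K).toAffine.Point) -
        m • Affine.Point.some _ _ hP ∈ AddCommGroup.torsion (W₀.baseChange K).toAffine.Point) :
    ∀ Z T : (W₀.baseChange K).toAffine.Point, IsOfFinAddOrder T →
      (Affine.Point.some _ _ hP : (W₀.baseChange K).toAffine.Point) ≠ (2 : ℤ) • Z + T := by
  -- the non-trivial automorphism of `K/ℚ`
  obtain ⟨t, c, ht, htc⟩ :=
    Literature.NumberTheory.QuadraticFields.Quadratic.exists_sq_eq_algebraMap (F := ℚ) (K := K) h2K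
  have hσ : Literature.NumberTheory.QuadraticFields.Quadratic.conj h2K ht htc ≠ AlgHom.id ℚ K := by
    intro h
    have hgen' := Literature.NumberTheory.QuadraticFields.Quadratic.conj_gen h2K ht htc
    rw [h, AlgHom.id_apply] at hgen'
    have ht0 : t = 0 := by linear_combination hgen' / 2
    exact ht ⟨0, by rw [_root_.map_zero, ht0]⟩
  -- first: `P ≠ 2·Q`
  have hhalf : ∀ Q : (W₀.baseChange K).toAffine.Point,
      (Affine.Point.some _ _ hP : (W₀.baseChange K).toAffine.Point) ≠ (2 : ℤ) • Q := by
    intro Q hPQ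
    set σ := Literature.NumberTheory.QuadraticFields.Quadratic.conj h2K ht htc with hσdef
    have hσP : Affine.Point.map (W' := W₀) σ (Affine.Point.some _ _ hP) =
        Affine.Point.some _ _ hP := by
      rw [Affine.Point.map_some]
      simp only [AlgHom.commutes]
    have h2d : (2 : ℤ) • (Affine.Point.map (W' := W₀) σ Q - Q) = 0 := by
      rw [smul_sub, ← map_zsmul, ← hPQ, hσP, sub_self]
    have hfix : Affine.Point.map (W' := W₀) σ Q = Q := sub_eq_zero.mp (hE2 _ h2d)
    rcases Q with _ | ⟨x, y, h⟩
    · rw [← Affine.Point.zero_def, smul_zero] at hPQ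
      exact Affine.Point.some_ne_zero _ hPQ
    · rw [Affine.Point.map_some, Affine.Point.some.injEq] at hfix
      obtain ⟨x', rfl⟩ :=
        Literature.NumberTheory.EllipticCurves.Quadratic.exists_eq_algebraMap_of_apply_eq h2K hσ hfix.1
      obtain ⟨y', rfl⟩ :=
        Literature.NumberTheory.EllipticCurves.Quadratic.exists_eq_algebraMap_of_apply_eq h2K hσ hfix.2
      obtain ⟨m, hm⟩ := hgen x' y' h
      have hm' : IsOfFinAddOrder ((Affine.Point.some _ _ h : (W₀.baseChange K).toAffine.Point) -
          m • Affine.Point.some _ _ hP) := (AddCommGroup.mem_torsion _).mp hm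
      -- `(1 − 2m)·P = 2·(Q − m·P)` is torsion, hence so is `P` (tree `isOfFinAddOrder_of_zsmul`)
      have e : (1 - 2 * m) • (Affine.Point.some _ _ hP : (W₀.baseChange K).toAffine.Point) =
          (2 : ℤ) • ((Affine.Point.some _ _ h : (W₀.baseChange K).toAffine.Point) -
            m • Affine.Point.some _ _ hP) := by
        rw [smul_sub, ← hPQ, sub_smul, one_smul, mul_smul]
      refine hPinf (Literature.NumberTheory.EllipticCurves.isOfFinAddOrder_of_zsmul
        (n := 1 - 2 * m) (by omega) ?_)
      rw [e]
      exact hm'.zsmul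
  intro Z T hT hPZ
  obtain ⟨T₁, -, rfl⟩ := exists_torsion_eq_two_smul hE2 hT
  exact hhalf (Z + T₁) (by rw [hPZ, smul_add])

end Generator

/-! ## §5 `E_p(K)[2] = 0` over a quadratic field — x1b GEN 47's
`SylvesterTwoFrame.two_torsion_eq_zero_cubeSumCurve_of_finrank_eq_two` (FrameConstants), re-keyed
to `ℤ`-scalars -/

section NoTwoTorsion

variable {K : Type} [Field K] [NumberField K]

/-- The Mordell form of `E_p ⊗ K`. [folklore] -/
theorem cubeSumCurve_baseChange_mordell (n : ℚ) :
    ((cubeSumCurve n).baseChange K).a₁ = 0 ∧ ((cubeSumCurve n).baseChange K).a₂ = 0 ∧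
      ((cubeSumCurve n).baseChange K).a₃ = 0 ∧ ((cubeSumCurve n).baseChange K).a₄ = 0 := by
  refine ⟨?_, ?_, ?_, ?_⟩ <;> simp [cubeSumCurve, WeierstrassCurve.baseChange]

/-- `E_p(K)[2] = 0` (`p` an odd prime, `K/ℚ` quadratic), in `ℤ`-scalar form: by name from x1b's
`two_torsion_eq_zero_cubeSumCurve_of_finrank_eq_two`. [cite: SilvermanAEC2009, III.2.3] -/
theorem eq_zero_of_two_zsmul_eq_zero (h2K : Module.finrank ℚ K = 2) {p : ℕ} (hp : p.Prime)
    (hp2 : p ≠ 2) (Q : ((cubeSumCurve (p : ℚ)).baseChange K).toAffine.Point)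
    (hQ : (2 : ℤ) • Q = 0) : Q = 0 :=
  SylvesterTwoFrame.two_torsion_eq_zero_cubeSumCurve_of_finrank_eq_two K h2K hp hp2 Q
    (by rw [two_nsmul]; rwa [two_zsmul] at hQ)

end NoTwoTorsion

/-! ## §6 The `2`-integrality of the `ℤ[ω]`-coordinate along Hu–Shu–Yin's generator -/

section Sylvester

variable {K : Type} [Field K] [NumberField K] {ω : K}

/-- **NON-NEGATIVITY along the generator (the `p ≡ 4 (mod 9)` layer of 19580).** Over a quadratic
number field `K ∋ ω`, on `E_p ⊗ K` (`p` an odd prime) with `θ = [ω]`, let `P` be a point with rational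
coordinates, of infinite order, through which every rational-coordinate point is an integer
multiple modulo torsion (Hu–Shu–Yin's generator of `E_p(ℚ)`), and let `n·Y = a·P + b·θP + T`
(`n ≠ 0`, `T` torsion; Hu–Shu–Yin p. 8: `K ⊗_{𝒪_K} E_p(K) ≃ K`). Then
`0 ≤ ord₂((a² − ab + b²)/n²)` — so in the display `#Ш_an(E_p)·#Ш_an(E_{3p²}) = 2^i·(a² − ab + b²)/n²`
the case `i = 0` (`p ≡ 4 (9)`) has non-negative `2`-adic valuation.
[cite: HuShuYin2019, pp. 8, 12] -/
theorem padicValRat_two_coordinate_nonneg (h2K : Module.finrank ℚ K = 2) (hω : ω ^ 2 + ω + 1 = 0)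
    {p : ℕ} (hp : p.Prime) (hp2 : p ≠ 2)
    (h1 : ((cubeSumCurve (p : ℚ)).baseChange K).a₁ = 0) (h2 : ((cubeSumCurve (p : ℚ)).baseChange K).a₂ = 0)
    (h3 : ((cubeSumCurve (p : ℚ)).baseChange K).a₃ = 0) (h4 : ((cubeSumCurve (p : ℚ)).baseChange K).a₄ = 0)
    {θ : ((cubeSumCurve (p : ℚ)).baseChange K).toAffine.Point →
      ((cubeSumCurve (p : ℚ)).baseChange K).toAffine.Point} (hθ0 : θ 0 = 0)
    (hθ : ∀ (x y : K) (h : ((cubeSumCurve (p : ℚ)).baseChange K).toAffine.Nonsingular x y),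
      θ (.some x y h) = .some (ω * x) y (nonsingular_omega_mul hω h1 h2 h3 h4 h))
    {xP yP : ℚ}
    (hP : ((cubeSumCurve (p : ℚ)).baseChange K).toAffine.Nonsingular (algebraMap ℚ K xP)
      (algebraMap ℚ K yP))
    (hPinf : ¬ IsOfFinAddOrder
      (Affine.Point.some _ _ hP : ((cubeSumCurve (p : ℚ)).baseChange K).toAffine.Point))
    (hgen : ∀ (x y : ℚ) (hQ : ((cubeSumCurve (p : ℚ)).baseChange K).toAffine.Nonsingular
        (algebraMap ℚ K x) (algebraMap ℚ K y)),
      ∃ m : ℤ, (Affine.Point.some _ _ hQ : ((cubeSumCurve (p : ℚ)).baseChange K).toAffine.Point) -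
        m • Affine.Point.some _ _ hP ∈
          AddCommGroup.torsion ((cubeSumCurve (p : ℚ)).baseChange K).toAffine.Point)
    {Y T : ((cubeSumCurve (p : ℚ)).baseChange K).toAffine.Point} {n a b : ℤ} (hn : n ≠ 0)
    (hT : IsOfFinAddOrder T) (hY : n • Y = a • Affine.Point.some _ _ hP + b • θ (.some _ _ hP) + T) :
    0 ≤ padicValRat 2 (((a ^ 2 - a * b + b ^ 2 : ℤ) : ℚ) / ((n : ℚ) ^ 2)) :=
  padicValRat_two_norm_div_sq_nonneg hω h1 h2 h3 h4 hθ0 hθ (omega_ne_one hω)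
    (ne_two_smul_add_torsion_of_generator h2K (eq_zero_of_two_zsmul_eq_zero h2K hp hp2) hP hPinf hgen)
    n.natAbs le_rfl hn hT hY

/-- **The `p ≡ 7 (mod 9)` layer, modulo MEMO THEOREM C as a displayed hypothesis.** Same setting;
with `(a, b) ≠ (0, 0)`, if moreover Hu–Shu–Yin's point is `2`-DIVISIBLE over `K` modulo torsion
(`Y = 2·Y′ + T′` — MEMO
bsd-cm-two v2.6 §15.5 THEOREM C for `p ≡ 7 (9)`: Shimura reciprocity on `X_0(3⁵)`; refereed, NOT in
print, NOT proved here), then `2 ≤ ord₂((a² − ab + b²)/n²)` — compensating `i = −2`.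
[cite: HuShuYin2019, pp. 8, 12] -/
theorem two_le_padicValRat_two_coordinate_of_twoDivisible (h2K : Module.finrank ℚ K = 2)
    (hω : ω ^ 2 + ω + 1 = 0) {p : ℕ} (hp : p.Prime) (hp2 : p ≠ 2)
    (h1 : ((cubeSumCurve (p : ℚ)).baseChange K).a₁ = 0) (h2 : ((cubeSumCurve (p : ℚ)).baseChange K).a₂ = 0)
    (h3 : ((cubeSumCurve (p : ℚ)).baseChange K).a₃ = 0) (h4 : ((cubeSumCurve (p : ℚ)).baseChange K).a₄ = 0)
    {θ : ((cubeSumCurve (p : ℚ)).baseChange K).toAffine.Point →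
      ((cubeSumCurve (p : ℚ)).baseChange K).toAffine.Point} (hθ0 : θ 0 = 0)
    (hθ : ∀ (x y : K) (h : ((cubeSumCurve (p : ℚ)).baseChange K).toAffine.Nonsingular x y),
      θ (.some x y h) = .some (ω * x) y (nonsingular_omega_mul hω h1 h2 h3 h4 h))
    {xP yP : ℚ}
    (hP : ((cubeSumCurve (p : ℚ)).baseChange K).toAffine.Nonsingular (algebraMap ℚ K xP)
      (algebraMap ℚ K yP))
    (hPinf : ¬ IsOfFinAddOrder
      (Affine.Point.some _ _ hP : ((cubeSumCurve (p : ℚ)).baseChange K).toAffine.Point))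
    (hgen : ∀ (x y : ℚ) (hQ : ((cubeSumCurve (p : ℚ)).baseChange K).toAffine.Nonsingular
        (algebraMap ℚ K x) (algebraMap ℚ K y)),
      ∃ m : ℤ, (Affine.Point.some _ _ hQ : ((cubeSumCurve (p : ℚ)).baseChange K).toAffine.Point) -
        m • Affine.Point.some _ _ hP ∈
          AddCommGroup.torsion ((cubeSumCurve (p : ℚ)).baseChange K).toAffine.Point)
    {Y T : ((cubeSumCurve (p : ℚ)).baseChange K).toAffine.Point} {n a b : ℤ} (hn : n ≠ 0)
    (hT : IsOfFinAddOrder T) (hY : n • Y = a • Affine.Point.some _ _ hP + b • θ (.some _ _ hP) + T)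
    (hab : ¬ (a = 0 ∧ b = 0))
    (hC : ∃ Y' T' : ((cubeSumCurve (p : ℚ)).baseChange K).toAffine.Point,
      IsOfFinAddOrder T' ∧ Y = (2 : ℤ) • Y' + T') :
    2 ≤ padicValRat 2 (((a ^ 2 - a * b + b ^ 2 : ℤ) : ℚ) / ((n : ℚ) ^ 2)) := by
  obtain ⟨Y', T', hT', rfl⟩ := hC
  -- `(2n)·Y' = a·P + b·θP + (T − n·T')`
  have hY' : (2 * n) • Y' = a • Affine.Point.some _ _ hP + b • θ (.some _ _ hP) + (T - n • T') := by
    rw [mul_comm, mul_smul, ← add_sub_assoc, ← hY, smul_add]; abel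
  have h0 := padicValRat_two_norm_div_sq_nonneg hω h1 h2 h3 h4 hθ0 hθ (omega_ne_one hω)
    (ne_two_smul_add_torsion_of_generator h2K (eq_zero_of_two_zsmul_eq_zero h2K hp hp2) hP hPinf hgen)
    (2 * n).natAbs le_rfl (mul_ne_zero two_ne_zero hn)
    (by rw [sub_eq_add_neg]; exact hT.add hT'.zsmul.neg) hY'
  have hN : (a ^ 2 - a * b + b ^ 2 : ℤ) ≠ 0 := by
    intro h0
    apply hab
    have h4 : (2 * a - b) ^ 2 + 3 * b ^ 2 = 0 := by linear_combination 4 * h0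
    have hb : b = 0 := by nlinarith [sq_nonneg (2 * a - b), sq_nonneg b]
    subst hb
    refine ⟨?_, rfl⟩
    nlinarith [sq_nonneg a]
  · have hnQ : (n : ℚ) ≠ 0 := by exact_mod_cast hn
    have hNQ : ((a ^ 2 - a * b + b ^ 2 : ℤ) : ℚ) ≠ 0 := by exact_mod_cast hN
    have e : (((a ^ 2 - a * b + b ^ 2 : ℤ) : ℚ) / (((2 * n : ℤ) : ℚ) ^ 2)) =
        (((a ^ 2 - a * b + b ^ 2 : ℤ) : ℚ) / ((n : ℚ) ^ 2)) / 4 := by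
      push_cast; field_simp; ring
    rw [e, padicValRat.div (div_ne_zero hNQ (pow_ne_zero 2 hnQ)) (by norm_num),
      show (4 : ℚ) = 2 ^ 2 by norm_num, padicValRat.pow,
      show padicValRat 2 (2 : ℚ) = 1 by exact_mod_cast padicValRat.self one_lt_two] at h0
    push_cast at h0 ⊢
    linarith

end Sylvester

end Summit.BirchSwinnertonDyer.BirchSwinnertonDyer.Theorems.SylvesterTwoNonneg

end
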